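import Mathlib
import Literature.NumberTheory.LFunctions.Zhang2022.AppendixBLemma151Mu1Circles
import Literature.NumberTheory.LFunctions.Zhang2022.AppendixBLemma151Mu1Value
import Literature.NumberTheory.LFunctions.Zhang2022.AppendixBPerronGeneric
import Literature.NumberTheory.LFunctions.Zhang2022.AppendixBLemma151AssemblyGeneric
import Literature.NumberTheory.LFunctions.Zhang2022.AppendixBLemma151MuOneE
import Literature.NumberTheory.LFunctions.Zhang2022.AppendixBTailB3Value
import Literature.NumberTheory.LFunctions.Zhang2022.AppendixBTailB3Fubini
import Literature.NumberTheory.LFunctions.Zhang2022.AppendixBVarrhoNodes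
import Literature.NumberTheory.LFunctions.Zhang2022.Section15EChain
import HarnessLib

/-!
# Zhang (2022) App. B, proof of Lemma 15.1, `μ = 1`: `Typed.AppendixB.StepB_u012R` from the line→circle
# bound ALONE, and Lemma 15.1 (χ-reading, E-generic) packaged from the four Appendix-B legs

Topic `Literature/NumberTheory/LFunctions/Zhang2022` (Landau–Siegel audit tree; verdict-neutral).
Y. Zhang, *Discrete mean estimates and the Landau–Siegel zero*, arXiv:2211.02515v1 (2022)
[Zhang2022LandauSiegel] — **an unrefereed manuscript under adjudication; nothing in this file asserts
any claim of the manuscript beyond the implications it PROVES.** ZHANG-L discharge lane (WP15, App. B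
leg B4 under leaf `Typed.Section15C.Eq15_22` → `Eq15_22E e1ppD`, Lemma 15.1 χR(E); seat zl-w09-p5).
DAG node `Z22:§B.u012` [Z22 p.107, tex L5311] and Lemma 15.1 [p.80].

* `stepB_u012R_of_lineToCircle` — the `μ = 1` leg `StepB_u012R c′` (`Σ_l ϰ₁(l₁l)ϱ_j(l)/l = e′_{1j} + O(α₁)`)
  from the ONE remaining analytic input, the `μ = 1` line→circle bound
  `‖(1/2πi)∫_{(1)} ζ(1+s)/ζ(1+s−β_j)·(P₁/l₁)ˢ/((log P₁)(s−β₆)²) ds − (2πi)⁻¹∮_{|s|=5α}(same)‖ ≤ C·α₁`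
  (an instance of the lane's generic App. B contour engine `AppendixBLineToCircleGeneric`, zl-libA-p6 /
  zl-closer-4): the Perron identity (`Skeleton.vkSum_vk1_eq_vline`, `AppendixBPerronGeneric`), the
  two-circle split and the residue at `0` (`AppendixBLemma151Mu1Circles`) and the value of the `β₆`-circle
  (`AppendixBLemma151Mu1Value`) being theorems — the `μ = 1` twin of zl-closer-4's
  `stepB_mu3R_of_perron_shift`;
* `lemma151ChiRE_of_appB_legs (e1pp)` — Lemma 15.1 in the χ-reading at a GENERAL (B.3)-tail value `e1pp`
  (`Skeleton.Lemma151ChiRE e1pp c′`, RT-05) from `StepB_mu2R`, `StepB_mu3R`, `StepB_u012R` and a tail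
  evaluation `tailB3 = e1pp + O(α₁)`: `lemma151ChiRE_of_evals` ((B.1)/(B.2) theorems `eqB_1_holds`,
  `eqB_2_holds`) ∘ `hmu1E_of_u012R_tail`; and `lemma151ChiRE_e1ppD_of_appB_legs` — the reading of RECORD
  `e1pp := e1ppD` (R-28) from `StepB_mu2R`, `StepB_mu3R`, `StepB_u012R`, `StepB_u015bR`
  (`tailB3_sub_e1ppD_of` with `stepB_u015aR_holds`). These are the by-name inputs of the §15/§16/§17
  E-chains (`eq15_22E_of_lemma151ChiRE`, the `Eq16_16R2E`/`Eq17_9RelE` assemblies).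

WHAT THIS IS NOT: the line→circle bound itself, the legs `μ = 2, 3`, (B.3), or any claim about
Theorems 1–2 / Landau–Siegel zeros.

## References

* Y. Zhang, arXiv:2211.02515v1 (2022), App. B pp. 106–108; §15 Lemma 15.1 p. 80.
  [cite: Zhang2022LandauSiegel, App. B p.107]
-/

noncomputable section

open Complex Real

namespace Literature.NumberTheory.LFunctions.Zhang2022.Skeleton

open Typed.AppendixB (zetaRatio kerB vline)

variable (c' : ℝ)

/-- **`StepB_u012R c′` from the `μ = 1` line→circle bound alone** ("The same argument also gives
`Σ_l ϰ₁(l₁l)ϱ_j(l)/l = e′_{1j} + O(α₁)`", App. B p. 107; reading `α₁ = α log T`): the `μ = 1` Perron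
identity (`Skeleton.vkSum_vk1_eq_vline`), the two-circle split with the residue at `0`
(`Skeleton.stepB_u012R_of`) and the value of the `β₆`-circle (`circleIntegral_intB1_beta6_sub_main_le`)
are theorems, so the leg needs only `‖vline 1 (intB1) − (2πi)⁻¹∮_{|s|=5α} intB1‖ ≤ C·α₁` for
`1 ≤ l₁ < T`, `l₁ ∈ 𝔫(𝔮)`. [cite: Zhang2022LandauSiegel, App. B p.107] -/
theorem stepB_u012R_of_lineToCircle
    (h9r : ∃ C : ℝ, ForAllLarge fun D _ _ => ∀ j ∈ ({1, 2, 3} : Finset ℕ), ∀ l₁ : ℕ, 1 ≤ l₁ →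
      l₁ ∈ nset (frakq D) → (l₁ : ℝ) < bigT D →
        ‖vline 1 (fun s => zetaRatio c' D j s * kerB (P1 D) (beta6 D) l₁ s) -
            (2 * π * I)⁻¹ * (∮ s in C((0 : ℂ), 5 * alpha D), zetaRatio c' D j s * kerB (P1 D) (beta6 D) l₁ s)‖ ≤
          C * alpha1 D) :
    Typed.AppendixB.StepB_u012R c' :=
  stepB_u012R_of c' (vkSum_vk1_eq_vline c') h9r (circleIntegral_intB1_beta6_sub_main_le c')

/-- Lemma 15.1 in the χ-reading at a GENERAL (B.3)-tail value `e1pp`, from the four Appendix-B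
one-variable evaluations (`μ = 2`, `μ = 3`, `μ = 1`, tail): packaging of
`lemma151ChiRE_of_evals` ∘ `hmu1E_of_u012R_tail` with (B.1)/(B.2) theorems, for the §15/§16/§17
E-chains (which consume `Lemma151ChiRE e1pp c′` BY NAME). [cite: Zhang2022LandauSiegel, Lemma 15.1 p.80; App. B] -/
theorem lemma151ChiRE_of_appB_legs (e1pp : ℕ → ℂ)
    (hmu2 : Typed.AppendixB.StepB_mu2R c') (hmu3 : Typed.AppendixB.StepB_mu3R c')
    (h12 : Typed.AppendixB.StepB_u012R c')
    (hB3 : ∃ C : ℝ, ForAllLarge fun D _ _ => ∀ j ∈ ({1, 2, 3} : Finset ℕ), ∀ l₁ : ℕ, 1 ≤ l₁ →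
      l₁ ∈ nset (frakq D) → (l₁ : ℝ) < bigT D →
        ‖Typed.AppendixB.tailB3 c' D j l₁ - e1pp j‖ ≤ C * alpha1 D) :
    Lemma151ChiRE e1pp c' :=
  lemma151ChiRE_of_evals e1pp c' (AppendixBVarrho.eqB_1_holds c') (AppendixBVarrho.eqB_2_holds c')
    hmu2 hmu3 (hmu1E_of_u012R_tail c' e1pp h12 hB3)

/-- Lemma 15.1 in the χ-reading of RECORD (`e1pp := e1ppD`, the DERIVED `e″₁ⱼ`; RT-05/R-28) from the
WP15-PLAN legs B1/B3/B4/B5: `StepB_mu2R → StepB_mu3R → StepB_u012R → StepB_u015bR → Lemma151ChiRE e1ppD c′`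
((B.3)-tail at `e1ppD` by `AppendixBVarrho.tailB3_sub_e1ppD_of` with `stepB_u015aR_holds`).
[cite: Zhang2022LandauSiegel, Lemma 15.1 p.80; App. B (B.3)] -/
theorem lemma151ChiRE_e1ppD_of_appB_legs
    (hmu2 : Typed.AppendixB.StepB_mu2R c') (hmu3 : Typed.AppendixB.StepB_mu3R c')
    (h12 : Typed.AppendixB.StepB_u012R c') (h15b : Typed.AppendixB.StepB_u015bR c') :
    Lemma151ChiRE e1ppD c' :=
  lemma151ChiRE_of_appB_legs c' e1ppD hmu2 hmu3 h12
    (AppendixBVarrho.tailB3_sub_e1ppD_of c' (AppendixBVarrho.stepB_u015aR_holds c') h15b)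

end Literature.NumberTheory.LFunctions.Zhang2022.Skeleton
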